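import Summits.QuantumAdvantage.QuantumAdvantage.Theorems.CubicForrelationNearExactIsExactKtThreeExceptional
import Summits.QuantumAdvantage.QuantumAdvantage.Theorems.CubicForrelationNearExactIsExactCubicFormRadical

/-!
# Crux `CubicForrelation.NearExactIsExact` (stmt-QuantumAdvantage-14043) — Kasami–Tokura for CUBICS, the EXCEPTIONAL word, II:
  STRUCTURE — a cubic with `32·#E = 7·2^m` ones supported in no affine hyperplane is `l·[⟨x,z₁⟩ = b₁]·[⟨x,z₂⟩ = b₂] ⊕ g` with `l`
  affine and `g` a minimum-weight cubic (its support an `(m−3)`-flat), the two supports of size `2^{m−3}` meeting in `2^{m−6}` points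
  (`≅ x₁x₂x₃ ⊕ x₄x₅x₆`)

Certificate seat `b2b-cforr-cert` (gen 41).  HONEST FRAMING: a coding-theory brick (standard axioms, no `decide` on data, uniform in `m`),
tool T4 of the Lean roadmap for `E1280-even` (HOME/b2b-cforr-cert-g40/LEAN-PLAN-E1280-EVEN.md §3; HOME/b2b-cforr-cert-g39/E1280-HANDPROOFS.md
App. A.1 "[Gap for Lean: the structural statement of the exceptional branch]"), completing …KtThreeExceptional (`kte_cells`).  With the
tree's `kt3_structure` this gives Kasami–Tokura's theorem for `r = 3` in structural form: a cubic with `0 < #E < 2^{m−2}` is `λ·q`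
(support in a hyperplane) or, after an affine change of coordinates, `x₁x₂x₃ ⊕ x₄x₅x₆`.  Nothing about `θ₁₂`; NOT summit progress.

THE ARGUMENT (continuing …KtThreeExceptional): with the cells of `kte_cells` (`U = {⟨x,z₁⟩ = b₁, ⟨x,z₂⟩ = b₂}`, `D_a c = 1_U`, far cells of
`2^{m−5}` points each):
* `kte_period`: `c·[⟨x,z_A⟩ ≠ b_A]` has degree `≤ 4` and `2^{m−4}` ones — a minimum-weight word of `RM(4,m)`, so its support is a flat
  (`mw_flat_of_minweight`); as it meets both sides of `⟨x,z_B⟩` it has a period `t` with `⟨t,z_A⟩ = 0`, `⟨t,z_B⟩ = 1`.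
* `kte_exceptional_structure`: with such periods `t₁` (for `z₁`) and `t₂` (for `z₂`) put `l := D_{t₁}D_{t₂}c` (degree `≤ 1`).  For `y ∈ U`
  the period relations give `c(y⊕t₁) = c(y⊕t₂) = c(y⊕t₁⊕t₂)`, hence `c(y) ⊕ l(y) = c(y⊕t₁⊕t₂)` with `y⊕t₁⊕t₂` in the far cell; so
  `g := c ⊕ l·1_U` equals `c` off `U` and a translate of the far cell on `U`: `#supp g = 3·2^{m−5} + 2^{m−5} = 2^{m−3}`.  Translation by
  `a` flips `l` on `U` (…CubicFormRadical `tce_half`), so `l·1_U` has `2^{m−3}` ones too, and the bookkeeping `e₀ = r + p`, `#(l·1_U) =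
  r + q`, `2^{m−5} = p + q` on `U` gives `#(supp(l·1_U) ∩ supp g) = q = 2^{m−6}`.

References: T. Kasami, N. Tokura, *On the weight structure of Reed–Muller codes*, IEEE Trans. IT 16 (1970) 752–759, Thm 1;
F. J. MacWilliams, N. J. A. Sloane (1977) Ch. 15 §3.  Axioms: the standard three.
-/

set_option linter.dupNamespace false -- D-0017: single-problem summit ⇒ `QuantumAdvantage.QuantumAdvantage` by design

noncomputable section

namespace Summit.QuantumAdvantage.QuantumAdvantage.Theorems.CubicForrelation.NearExactIsExact

open Finset
open Literature.Computability.QuantumComplexity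
open Literature.Computability.QuantumComplexity.BuzetChailloux (bxor zeroVec bxor_bxor_cancel_left bxor_zeroVec zeroVec_bxor bxor_comm
  bxor_self bxor_eq_zeroVec_iff)
open Summit.QuantumAdvantage.QuantumAdvantage.Theorems.SignedCubicForrelationNotPrBPP (knf_isDegLeFun_ip)

/-- **A period across the other parity.**  If the far side `E ∩ {⟨x,z_A⟩ ≠ b_A}` of a cubic `c` has `2^{m−4}` points and meets both sides
of `⟨x,z_B⟩`, then `c·[⟨x,z_A⟩ ≠ b_A]` (a minimum-weight word of `RM(4,m)`, hence a flat) has a period `t` with `⟨t,z_A⟩ = 0`, `⟨t,z_B⟩ = 1`.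
[this work; cite: KasamiTokura1970, Thm 1] -/
theorem kte_period {m : ℕ} (c : (Fin m → Bool) → Bool) (hc : IsDegLeFun 3 c) (zA zB : Fin m → Bool) (bA bB : Bool)
    (hS : 16 * #(univ.filter fun x => c x = true ∧ decide (Odd #(univ.filter fun i => (x i && zA i) = true)) = !bA) = 2 ^ m)
    (h₀ : ∃ x, c x = true ∧ decide (Odd #(univ.filter fun i => (x i && zA i) = true)) = !bA ∧
      decide (Odd #(univ.filter fun i => (x i && zB i) = true)) = !bB)
    (h₂ : ∃ x, c x = true ∧ decide (Odd #(univ.filter fun i => (x i && zA i) = true)) = !bA ∧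
      decide (Odd #(univ.filter fun i => (x i && zB i) = true)) = bB) :
    ∃ t : Fin m → Bool,
      (∀ x, (c (bxor x t) && decide (decide (Odd #(univ.filter fun i => ((bxor x t) i && zA i) = true)) = !bA)) =
        (c x && decide (decide (Odd #(univ.filter fun i => (x i && zA i) = true)) = !bA))) ∧
      decide (Odd #(univ.filter fun i => (t i && zA i) = true)) = false ∧
      decide (Odd #(univ.filter fun i => (t i && zB i) = true)) = true := by
  classical
  set PA : (Fin m → Bool) → Bool := fun x => decide (Odd #(univ.filter fun i => (x i && zA i) = true)) with hPA
  set PB : (Fin m → Bool) → Bool := fun x => decide (Odd #(univ.filter fun i => (x i && zB i) = true)) with hPB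
  have hPAx : ∀ x y, PA (bxor x y) = (PA x ^^ PA y) := fun x y => by rw [hPA]; exact tow_parity_bxor x y zA
  have hPBx : ∀ x y, PB (bxor x y) = (PB x ^^ PB y) := fun x y => by rw [hPB]; exact tow_parity_bxor x y zB
  set cA : (Fin m → Bool) → Bool := fun x => c x && decide (PA x = !bA) with hcA
  -- degree ≤ 4 and minimum weight
  have hdeg1 : IsDegLeFun 1 (fun x => decide (PA x = !bA)) := by
    have e : (fun x => decide (PA x = !bA)) = fun x => PA x ^^ bA := funext fun x => by
      cases PA x <;> cases bA <;> rfl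
    rw [e]
    exact fc_deg_bxor (by rw [hPA]; exact knf_isDegLeFun_ip zA) (isDegLeFun_const 1 bA)
  have hcAdeg : IsDegLeFun (3 + 1) cA := bb_deg_and hc hdeg1 le_rfl
  have hsupp : (univ.filter fun x => cA x = true) = univ.filter fun x => c x = true ∧ PA x = !bA := by
    refine filter_congr fun x _ => ?_
    rw [hcA]; simp only [Bool.and_eq_true, decide_eq_true_eq]
  have hS' : 2 ^ (3 + 1) * #(univ.filter fun x => cA x = true) = 2 ^ m := by
    rw [hsupp]; norm_num; exact hS
  obtain ⟨-, -, -, hVimg⟩ := mw_flat_of_minweight 3 cA hcAdeg hS'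
  obtain ⟨x₀, hx₀c, hx₀A, hx₀B⟩ := h₀
  obtain ⟨x₂, hx₂c, hx₂A, hx₂B⟩ := h₂
  change PA x₀ = !bA at hx₀A
  change PB x₀ = !bB at hx₀B
  change PA x₂ = !bA at hx₂A
  change PB x₂ = bB at hx₂B
  have hcx₀ : cA x₀ = true := by rw [hcA]; simp only [hx₀c, hx₀A, decide_true, Bool.and_self]
  have hcx₂ : cA x₂ = true := by rw [hcA]; simp only [hx₂c, hx₂A, decide_true, Bool.and_self]
  have hx₂mem : x₂ ∈ (univ.filter fun x => cA x = true) := mem_filter.2 ⟨mem_univ _, hcx₂⟩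
  rw [hVimg x₀ hcx₀, mem_image] at hx₂mem
  obtain ⟨t, ht, htx⟩ := hx₂mem
  have hper := (mem_filter.1 ht).2
  refine ⟨t, fun x => hper x, ?_, ?_⟩
  · change PA t = false
    have e := congrArg PA htx
    rw [hPAx, hx₀A, hx₂A] at e
    revert e; cases PA t <;> cases bA <;> decide
  · change PB t = true
    have e := congrArg PB htx
    rw [hPBx, hx₀B, hx₂B] at e
    revert e; cases PB t <;> cases bB <;> decide

/-- **Kasami–Tokura, the exceptional word: structure.**  A cubic `c` on `m` bits with `32·#E = 7·2^m` whose support lies in no affine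
hyperplane is `c = l·[⟨x,z₁⟩ = b₁]·[⟨x,z₂⟩ = b₂] ⊕ g` with `l` affine (`deg ≤ 1`), `z₁ ≠ z₂` non-zero, and `g` a cubic with `2^{m−3}` ones
(so `supp g` is an `(m−3)`-flat by `mw_flat_of_minweight`); the product has `2^{m−3}` ones as well and the two supports meet in `2^{m−6}`
points.  Up to an affine change of coordinates this is `x₁x₂x₃ ⊕ x₄x₅x₆`. [this work; cite: KasamiTokura1970, Thm 1] -/
theorem kte_exceptional_structure {m : ℕ} (c : (Fin m → Bool) → Bool) (hc : IsDegLeFun 3 c)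
    (hw : 32 * #(univ.filter fun x => c x = true) = 7 * 2 ^ m)
    (hgen : ¬ ∃ (z : Fin m → Bool) (b : Bool), z ≠ zeroVec ∧
        ∀ x, c x = true → decide (Odd #(univ.filter fun i => (x i && z i) = true)) = b) :
    ∃ (l g : (Fin m → Bool) → Bool) (z₁ z₂ : Fin m → Bool) (b₁ b₂ : Bool),
      IsDegLeFun 1 l ∧ IsDegLeFun 3 g ∧ z₁ ≠ zeroVec ∧ z₂ ≠ zeroVec ∧ z₁ ≠ z₂ ∧
      8 * #(univ.filter fun x => g x = true) = 2 ^ m ∧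
      8 * #(univ.filter fun x => (l x && (decide (decide (Odd #(univ.filter fun i => (x i && z₁ i) = true)) = b₁) &&
        decide (decide (Odd #(univ.filter fun i => (x i && z₂ i) = true)) = b₂))) = true) = 2 ^ m ∧
      64 * #(univ.filter fun x => (l x && (decide (decide (Odd #(univ.filter fun i => (x i && z₁ i) = true)) = b₁) &&
        decide (decide (Odd #(univ.filter fun i => (x i && z₂ i) = true)) = b₂))) = true ∧ g x = true) = 2 ^ m ∧
      ∀ x, c x = ((l x && (decide (decide (Odd #(univ.filter fun i => (x i && z₁ i) = true)) = b₁) &&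
        decide (decide (Odd #(univ.filter fun i => (x i && z₂ i) = true)) = b₂))) ^^ g x) := by
  classical
  obtain ⟨a, z₁, z₂, b₁, b₂, -, hz₁, hz₂, hz12, ha₁, ha₂, hD, he₀, he₂, he₁, he₃⟩ := kte_cells c hc hw hgen
  set P₁ : (Fin m → Bool) → Bool := fun x => decide (Odd #(univ.filter fun i => (x i && z₁ i) = true)) with hP₁
  set P₂ : (Fin m → Bool) → Bool := fun x => decide (Odd #(univ.filter fun i => (x i && z₂ i) = true)) with hP₂
  have hP₁x : ∀ x y, P₁ (bxor x y) = (P₁ x ^^ P₁ y) := fun x y => by rw [hP₁]; exact tow_parity_bxor x y z₁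
  have hP₂x : ∀ x y, P₂ (bxor x y) = (P₂ x ^^ P₂ y) := fun x y => by rw [hP₂]; exact tow_parity_bxor x y z₂
  change P₁ a = false at ha₁
  change P₂ a = false at ha₂
  have hD' : ∀ x, (c x ^^ c (bxor x a)) = (decide (P₁ x = b₁) && decide (P₂ x = b₂)) := fun x => hD x
  set e₀ := #(univ.filter fun x => c x = true ∧ P₁ x = b₁ ∧ P₂ x = b₂) with he₀def
  set e₁ := #(univ.filter fun x => c x = true ∧ P₁ x = b₁ ∧ P₂ x = !b₂) with he₁def
  set e₂ := #(univ.filter fun x => c x = true ∧ P₁ x = !b₁ ∧ P₂ x = b₂) with he₂def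
  set e₃ := #(univ.filter fun x => c x = true ∧ P₁ x = !b₁ ∧ P₂ x = !b₂) with he₃def
  change 8 * e₀ = 2 ^ m at he₀
  change 32 * e₂ = 2 ^ m at he₂
  change 32 * e₁ = 2 ^ m at he₁
  change 32 * e₃ = 2 ^ m at he₃
  have hTpos : 0 < 2 ^ m := by positivity
  -- 1. the two periods
  have hside₁ : 16 * #(univ.filter fun x => c x = true ∧ P₁ x = !b₁) = 2 ^ m := by
    have eA : (univ.filter fun x => (c x = true ∧ P₁ x = !b₁) ∧ P₂ x = b₂) =
        univ.filter fun x => c x = true ∧ P₁ x = !b₁ ∧ P₂ x = b₂ := filter_congr fun x _ => and_assoc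
    have eB : (univ.filter fun x => (c x = true ∧ P₁ x = !b₁) ∧ P₂ x = !b₂) =
        univ.filter fun x => c x = true ∧ P₁ x = !b₁ ∧ P₂ x = !b₂ := filter_congr fun x _ => and_assoc
    rw [kte_filter_split b₂ P₂ (fun x => c x = true ∧ P₁ x = !b₁), eA, eB]; omega
  have hside₂ : 16 * #(univ.filter fun x => c x = true ∧ P₂ x = !b₂) = 2 ^ m := by
    have eA : (univ.filter fun x => (c x = true ∧ P₂ x = !b₂) ∧ P₁ x = b₁) =
        univ.filter fun x => c x = true ∧ P₁ x = b₁ ∧ P₂ x = !b₂ :=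
      filter_congr fun x _ => ⟨fun ⟨⟨h1, h2⟩, h3⟩ => ⟨h1, h3, h2⟩, fun ⟨h1, h2, h3⟩ => ⟨⟨h1, h3⟩, h2⟩⟩
    have eB : (univ.filter fun x => (c x = true ∧ P₂ x = !b₂) ∧ P₁ x = !b₁) =
        univ.filter fun x => c x = true ∧ P₁ x = !b₁ ∧ P₂ x = !b₂ :=
      filter_congr fun x _ => ⟨fun ⟨⟨h1, h2⟩, h3⟩ => ⟨h1, h3, h2⟩, fun ⟨h1, h2, h3⟩ => ⟨⟨h1, h3⟩, h2⟩⟩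
    rw [kte_filter_split b₁ P₁ (fun x => c x = true ∧ P₂ x = !b₂), eA, eB]; omega
  obtain ⟨x₃, hx₃⟩ : (univ.filter fun x => c x = true ∧ P₁ x = !b₁ ∧ P₂ x = !b₂).Nonempty := by
    rw [← card_pos]; change 0 < e₃; omega
  obtain ⟨hx₃c, hx₃1, hx₃2⟩ := (mem_filter.1 hx₃).2
  obtain ⟨x₂, hx₂⟩ : (univ.filter fun x => c x = true ∧ P₁ x = !b₁ ∧ P₂ x = b₂).Nonempty := by
    rw [← card_pos]; change 0 < e₂; omega
  obtain ⟨hx₂c, hx₂1, hx₂2⟩ := (mem_filter.1 hx₂).2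
  obtain ⟨x₁, hx₁⟩ : (univ.filter fun x => c x = true ∧ P₁ x = b₁ ∧ P₂ x = !b₂).Nonempty := by
    rw [← card_pos]; change 0 < e₁; omega
  obtain ⟨hx₁c, hx₁1, hx₁2⟩ := (mem_filter.1 hx₁).2
  obtain ⟨t₁, ht₁per, ht₁A, ht₁B⟩ :=
    kte_period c hc z₁ z₂ b₁ b₂ hside₁ ⟨x₃, hx₃c, hx₃1, hx₃2⟩ ⟨x₂, hx₂c, hx₂1, hx₂2⟩
  obtain ⟨t₂, ht₂per, ht₂A, ht₂B⟩ :=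
    kte_period c hc z₂ z₁ b₂ b₁ hside₂ ⟨x₃, hx₃c, hx₃2, hx₃1⟩ ⟨x₁, hx₁c, hx₁2, hx₁1⟩
  change P₁ t₁ = false at ht₁A
  change P₂ t₁ = true at ht₁B
  change P₂ t₂ = false at ht₂A
  change P₁ t₂ = true at ht₂B
  have ht₁per' : ∀ x, (c (bxor x t₁) && decide (P₁ (bxor x t₁) = !b₁)) = (c x && decide (P₁ x = !b₁)) := fun x => ht₁per x
  have ht₂per' : ∀ x, (c (bxor x t₂) && decide (P₂ (bxor x t₂) = !b₂)) = (c x && decide (P₂ x = !b₂)) := fun x => ht₂per x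
  -- 2. the affine factor `l = D_{t₁} D_{t₂} c` and the key identity on `U`
  set l : (Fin m → Bool) → Bool := fun x => (c x ^^ c (bxor x t₂)) ^^ (c (bxor x t₁) ^^ c (bxor (bxor x t₁) t₂)) with hl
  have hldeg : IsDegLeFun 1 l := stub_derivDegree m 1 (fun x => c x ^^ c (bxor x t₂)) t₁ (stub_derivDegree m 2 c t₂ hc)
  have hkey : ∀ y, P₁ y = b₁ → P₂ y = b₂ → (c y ^^ l y) = c (bxor (bxor y t₁) t₂) := by
    intro y h1 h2
    have e1 := ht₁per' (bxor y t₂)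
    have p1 : P₁ (bxor y t₂) = !b₁ := by rw [hP₁x, h1, ht₂B]; cases b₁ <;> rfl
    have p1' : P₁ (bxor (bxor y t₂) t₁) = !b₁ := by rw [hP₁x, p1, ht₁A, Bool.xor_false]
    rw [p1, p1'] at e1; simp only [decide_true, Bool.and_true] at e1
    have e2 := ht₂per' (bxor y t₁)
    have p2 : P₂ (bxor y t₁) = !b₂ := by rw [hP₂x, h2, ht₁B]; cases b₂ <;> rfl
    have p2' : P₂ (bxor (bxor y t₁) t₂) = !b₂ := by rw [hP₂x, p2, ht₂A, Bool.xor_false]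
    rw [p2, p2'] at e2; simp only [decide_true, Bool.and_true] at e2
    have ecomm : bxor (bxor y t₂) t₁ = bxor (bxor y t₁) t₂ := by
      rw [iw_bxor_assoc, iw_bxor_assoc, bxor_comm t₂ t₁]
    rw [ecomm] at e1
    rw [hl]; simp only
    rw [← e2, e1]
    cases c y <;> cases c (bxor y t₂) <;> rfl
  -- 3. the minimum-weight remainder
  set g : (Fin m → Bool) → Bool := fun x => c x ^^ (l x && (decide (P₁ x = b₁) && decide (P₂ x = b₂))) with hg
  have hd1 : IsDegLeFun 1 (fun x => decide (P₁ x = b₁)) := by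
    have e : (fun x => decide (P₁ x = b₁)) = fun x => P₁ x ^^ !b₁ := funext fun x => by cases P₁ x <;> cases b₁ <;> rfl
    rw [e]; exact fc_deg_bxor (by rw [hP₁]; exact knf_isDegLeFun_ip z₁) (isDegLeFun_const 1 (!b₁))
  have hd2 : IsDegLeFun 1 (fun x => decide (P₂ x = b₂)) := by
    have e : (fun x => decide (P₂ x = b₂)) = fun x => P₂ x ^^ !b₂ := funext fun x => by cases P₂ x <;> cases b₂ <;> rfl
    rw [e]; exact fc_deg_bxor (by rw [hP₂]; exact knf_isDegLeFun_ip z₂) (isDegLeFun_const 1 (!b₂))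
  have hAdeg : IsDegLeFun 3 (fun x => l x && (decide (P₁ x = b₁) && decide (P₂ x = b₂))) :=
    bb_deg_and hldeg (bb_deg_and hd1 hd2 (le_refl 2)) (le_refl 3)
  have hgdeg : IsDegLeFun 3 g := fc_deg_bxor hc hAdeg
  have hdecomp : ∀ x, c x = ((l x && (decide (P₁ x = b₁) && decide (P₂ x = b₂))) ^^ g x) := fun x => by
    rw [hg]; simp only
    cases c x <;> cases (l x && (decide (P₁ x = b₁) && decide (P₂ x = b₂))) <;> rfl
  -- `g` on the four cells
  have hgU : ∀ x, P₁ x = b₁ → P₂ x = b₂ → g x = c (bxor (bxor x t₁) t₂) := by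
    intro x h1 h2; rw [← hkey x h1 h2, hg]; simp only [h1, h2, decide_true, Bool.and_self, Bool.and_true]
  have hgoff : ∀ x, ¬ (P₁ x = b₁ ∧ P₂ x = b₂) → g x = c x := by
    intro x hx; rw [hg]; simp only
    have : (decide (P₁ x = b₁) && decide (P₂ x = b₂)) = false := by
      rw [Bool.and_eq_false_iff]; by_cases h1 : P₁ x = b₁
      · right; simpa using fun h2 => hx ⟨h1, h2⟩
      · left; simpa using h1
    rw [this, Bool.and_false, Bool.xor_false]
  -- counting `g`: split by `P₁`, then by `P₂`
  have hsplitg : #(univ.filter fun x => g x = true) =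
      #(univ.filter fun x => g x = true ∧ P₁ x = b₁ ∧ P₂ x = b₂) + #(univ.filter fun x => g x = true ∧ P₁ x = b₁ ∧ P₂ x = !b₂) +
      (#(univ.filter fun x => g x = true ∧ P₁ x = !b₁ ∧ P₂ x = b₂) + #(univ.filter fun x => g x = true ∧ P₁ x = !b₁ ∧ P₂ x = !b₂)) := by
    have eassoc : ∀ (u v : Bool), (univ.filter fun x => (g x = true ∧ P₁ x = u) ∧ P₂ x = v) =
        univ.filter fun x => g x = true ∧ P₁ x = u ∧ P₂ x = v := fun u v => filter_congr fun x _ => and_assoc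
    rw [kte_filter_split b₁ P₁ (fun x => g x = true), kte_filter_split b₂ P₂ (fun x => g x = true ∧ P₁ x = b₁),
      kte_filter_split b₂ P₂ (fun x => g x = true ∧ P₁ x = !b₁), eassoc, eassoc, eassoc, eassoc]
  have hcell : ∀ (u v : Bool), ¬ (u = b₁ ∧ v = b₂) →
      #(univ.filter fun x => g x = true ∧ P₁ x = u ∧ P₂ x = v) = #(univ.filter fun x => c x = true ∧ P₁ x = u ∧ P₂ x = v) := by
    intro u v huv
    refine congrArg _ (filter_congr fun x _ => ?_)
    constructor
    · rintro ⟨hgx, h1, h2⟩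
      rw [hgoff x (fun h => huv ⟨h1 ▸ h.1.symm ▸ rfl, h2 ▸ h.2.symm ▸ rfl⟩)] at hgx; exact ⟨hgx, h1, h2⟩
    · rintro ⟨hcx, h1, h2⟩
      rw [← hgoff x (fun h => huv ⟨h1 ▸ h.1.symm ▸ rfl, h2 ▸ h.2.symm ▸ rfl⟩)] at hcx; exact ⟨hcx, h1, h2⟩
  -- the `U` cell of `g` is a translate of the far cell of `c`
  have hUcell : #(univ.filter fun x => g x = true ∧ P₁ x = b₁ ∧ P₂ x = b₂) = e₃ := by
    have hcancel : ∀ x : Fin m → Bool, bxor (bxor (bxor (bxor x t₁) t₂) t₁) t₂ = x := fun x => by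
      rw [iw_bxor_assoc (bxor x t₁) t₂ t₁, bxor_comm t₂ t₁, ← iw_bxor_assoc, iw_bxor_assoc x t₁ t₁, bxor_self, bxor_zeroVec,
        iw_bxor_assoc, bxor_self, bxor_zeroVec]
    have hinj : Function.Injective (fun x : Fin m → Bool => bxor (bxor x t₁) t₂) := fun x y hxy => by
      have e := congrArg (fun z : Fin m → Bool => bxor (bxor z t₁) t₂) hxy
      simp only [hcancel] at e; exact e
    rw [he₃def, ← card_image_of_injective (univ.filter fun x => g x = true ∧ P₁ x = b₁ ∧ P₂ x = b₂) hinj]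
    congr 1; ext y
    simp only [mem_image, mem_filter, mem_univ, true_and]
    constructor
    · rintro ⟨x, ⟨hgx, h1, h2⟩, rfl⟩
      refine ⟨by rw [← hgU x h1 h2]; exact hgx, ?_, ?_⟩
      · rw [hP₁x, hP₁x, h1, ht₁A, ht₂B]; cases b₁ <;> rfl
      · rw [hP₂x, hP₂x, h2, ht₁B, ht₂A]; cases b₂ <;> rfl
    · rintro ⟨hcy, h1, h2⟩
      have h1' : P₁ (bxor (bxor y t₁) t₂) = b₁ := by rw [hP₁x, hP₁x, h1, ht₁A, ht₂B]; cases b₁ <;> rfl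
      have h2' : P₂ (bxor (bxor y t₁) t₂) = b₂ := by rw [hP₂x, hP₂x, h2, ht₁B, ht₂A]; cases b₂ <;> rfl
      exact ⟨bxor (bxor y t₁) t₂, ⟨by rw [hgU _ h1' h2', hcancel]; exact hcy, h1', h2'⟩, hcancel y⟩
  have hgcard : 8 * #(univ.filter fun x => g x = true) = 2 ^ m := by
    rw [hsplitg, hUcell, hcell b₁ (!b₂) (fun h => by revert h; cases b₂ <;> simp),
      hcell (!b₁) b₂ (fun h => by revert h; cases b₁ <;> simp), hcell (!b₁) (!b₂) (fun h => by revert h; cases b₁ <;> simp)]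
    change 8 * (e₃ + e₁ + (e₂ + e₃)) = 2 ^ m
    omega
  -- 4. the product: `l` is balanced on `U` (translation by `a` flips it)
  have hUcard : 4 * #(univ.filter fun x => P₁ x = b₁ ∧ P₂ x = b₂) = 2 ^ m :=
    kt3_card_two_hyperplanes z₁ z₂ hz₁ hz₂ hz12 b₁ b₂
  have hgl : ∀ x, P₁ x = b₁ → P₂ x = b₂ → g x = (c x ^^ l x) := by
    intro x h1 h2; rw [hg]; simp only [h1, h2, decide_true, Bool.and_self, Bool.and_true]
  have hflip : ∀ x ∈ (univ.filter fun x => P₁ x = b₁ ∧ P₂ x = b₂), l (bxor x a) = !l x := by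
    intro x hx
    obtain ⟨h1, h2⟩ := (mem_filter.1 hx).2
    have h1a : P₁ (bxor x a) = b₁ := by rw [hP₁x, h1, ha₁, Bool.xor_false]
    have h2a : P₂ (bxor x a) = b₂ := by rw [hP₂x, h2, ha₂, Bool.xor_false]
    have k1 := hkey x h1 h2
    have k2 := hkey (bxor x a) h1a h2a
    have ecomm : bxor (bxor (bxor x a) t₁) t₂ = bxor (bxor (bxor x t₁) t₂) a := by
      rw [iw_bxor_assoc x a t₁, bxor_comm a t₁, ← iw_bxor_assoc x t₁ a, iw_bxor_assoc (bxor x t₁) a t₂, bxor_comm a t₂,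
        ← iw_bxor_assoc (bxor x t₁) t₂ a]
    rw [ecomm] at k2
    have hfar : P₁ (bxor (bxor x t₁) t₂) = !b₁ := by rw [hP₁x, hP₁x, h1, ht₁A, ht₂B]; cases b₁ <;> rfl
    have d1 := hD' (bxor (bxor x t₁) t₂)
    rw [hfar] at d1
    have hne : decide ((!b₁) = b₁) = false := by cases b₁ <;> rfl
    rw [hne, Bool.false_and] at d1
    have d2 := hD' x
    rw [h1, h2] at d2; simp only [decide_true, Bool.and_self] at d2
    revert k1 k2 d1 d2
    cases c x <;> cases l x <;> cases c (bxor x a) <;> cases l (bxor x a) <;> cases c (bxor (bxor x t₁) t₂) <;>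
      cases c (bxor (bxor (bxor x t₁) t₂) a) <;> decide
  obtain ⟨hA2, -⟩ := tce_half (univ.filter fun x => P₁ x = b₁ ∧ P₂ x = b₂) a l (fun x hx => by
      obtain ⟨h1, h2⟩ := (mem_filter.1 hx).2
      refine mem_filter.2 ⟨mem_univ _, ?_, ?_⟩
      · rw [hP₁x, h1, ha₁, Bool.xor_false]
      · rw [hP₂x, h2, ha₂, Bool.xor_false]) hflip
  rw [filter_filter] at hA2
  -- 5. bookkeeping on `U`: `e₀ = r + p`, `#A = r + q`, `e₃ = p + q`
  have hA : (univ.filter fun x => (l x && (decide (P₁ x = b₁) && decide (P₂ x = b₂))) = true) =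
      univ.filter fun x => (P₁ x = b₁ ∧ P₂ x = b₂) ∧ l x = true := by
    refine filter_congr fun x _ => ?_
    simp only [Bool.and_eq_true, decide_eq_true_eq]; tauto
  have hAG : (univ.filter fun x => (l x && (decide (P₁ x = b₁) && decide (P₂ x = b₂))) = true ∧ g x = true) =
      univ.filter fun x => ((P₁ x = b₁ ∧ P₂ x = b₂) ∧ l x = true) ∧ c x = false := by
    refine filter_congr fun x _ => ?_
    simp only [Bool.and_eq_true, decide_eq_true_eq]
    constructor
    · rintro ⟨⟨hl1, h1, h2⟩, hgx⟩
      refine ⟨⟨⟨h1, h2⟩, hl1⟩, ?_⟩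
      rw [hgl x h1 h2, hl1] at hgx; revert hgx; cases c x <;> decide
    · rintro ⟨⟨⟨h1, h2⟩, hl1⟩, hcx⟩
      refine ⟨⟨hl1, h1, h2⟩, ?_⟩
      rw [hgl x h1 h2, hl1, hcx]; rfl
  have he₀split := kte_filter_split true l (fun x => c x = true ∧ P₁ x = b₁ ∧ P₂ x = b₂)
  have hAsplit := kte_filter_split true c (fun x => (P₁ x = b₁ ∧ P₂ x = b₂) ∧ l x = true)
  have hGsplit := kte_filter_split true c (fun x => g x = true ∧ P₁ x = b₁ ∧ P₂ x = b₂)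
  simp only [Bool.not_true] at he₀split hAsplit hGsplit
  have err' : (univ.filter fun x => ((P₁ x = b₁ ∧ P₂ x = b₂) ∧ l x = true) ∧ c x = true) =
      univ.filter fun x => (c x = true ∧ P₁ x = b₁ ∧ P₂ x = b₂) ∧ l x = true :=
    filter_congr fun x _ => by tauto
  have epp' : (univ.filter fun x => (g x = true ∧ P₁ x = b₁ ∧ P₂ x = b₂) ∧ c x = true) =
      univ.filter fun x => (c x = true ∧ P₁ x = b₁ ∧ P₂ x = b₂) ∧ l x = false := by
    refine filter_congr fun x _ => ⟨?_, ?_⟩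
    · rintro ⟨⟨hgx, h1, h2⟩, hcx⟩
      refine ⟨⟨hcx, h1, h2⟩, ?_⟩
      rw [hgl x h1 h2, hcx] at hgx; revert hgx; cases l x <;> decide
    · rintro ⟨⟨hcx, h1, h2⟩, hl0⟩
      refine ⟨⟨?_, h1, h2⟩, hcx⟩
      rw [hgl x h1 h2, hcx, hl0]; rfl
  have eqq' : (univ.filter fun x => (g x = true ∧ P₁ x = b₁ ∧ P₂ x = b₂) ∧ c x = false) =
      univ.filter fun x => ((P₁ x = b₁ ∧ P₂ x = b₂) ∧ l x = true) ∧ c x = false := by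
    refine filter_congr fun x _ => ⟨?_, ?_⟩
    · rintro ⟨⟨hgx, h1, h2⟩, hcx⟩
      refine ⟨⟨⟨h1, h2⟩, ?_⟩, hcx⟩
      rw [hgl x h1 h2, hcx] at hgx; revert hgx; cases l x <;> decide
    · rintro ⟨⟨⟨h1, h2⟩, hl1⟩, hcx⟩
      refine ⟨⟨?_, h1, h2⟩, hcx⟩
      rw [hgl x h1 h2, hcx, hl1]; rfl
  rw [err'] at hAsplit
  rw [hUcell, epp', eqq'] at hGsplit
  refine ⟨l, g, z₁, z₂, b₁, b₂, hldeg, hgdeg, hz₁, hz₂, hz12, hgcard, ?_, ?_, fun x => hdecomp x⟩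
  · rw [hA]; omega
  · rw [hAG]; omega

end Summit.QuantumAdvantage.QuantumAdvantage.Theorems.CubicForrelation.NearExactIsExact

end
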